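import Mathlib
import HarnessLib

/-!
# Stability of positive definiteness: coercivity under small perturbations, uniformly on compact sets

Topic `Literature/Analysis/InnerProduct`. Elementary facts about continuous bilinear forms
`g : V →L V →L ℝ` on a real normed space used whenever a Riemannian metric is perturbed
("`h + δh` is again a Riemannian metric for `δh` small", e.g. the positivity part of step (iii)
of the assembly of the named fact
`Literature.Geometry.Lorentzian.ChruscielDelay_localConstraintDeformation`: a jointly continuous
family of data equal to a Riemannian `h` at the parameter `0` stays positive definite on a compact
coordinate ball for small parameters). Everything is PROVED; no definitions, no named facts.

* `mul_norm_sq_le_of_norm_sub_le` — **coercivity is stable**: if `λ‖v‖² ≤ g₀(v,v)` and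
  `‖g − g₀‖ ≤ μ` then `(λ − μ)‖v‖² ≤ g(v,v)`.
* `exists_pos_mul_norm_sq_le_of_pos` — on a finite-dimensional space a positive definite form is
  coercive, `∃ λ > 0, λ‖v‖² ≤ g(v,v)` (minimum over the unit sphere).
* `isOpen_setOf_posDef` — positive definite forms form an open set (finite dimension).
* `eventually_forall_mul_norm_sq_le` — **uniform coercivity near a parameter**: if
  `(p, x) ↦ g p x` is continuous on `N × K` (`N` a neighbourhood of `p₀`, `K` compact) and every
  `g p₀ x`, `x ∈ K`, is positive definite, then there is `λ > 0` with `λ‖v‖² ≤ g p x (v, v)` for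
  all `x ∈ K` and all `p` near `p₀` (compactness of `K × sphere`, then the tube lemma in the form
  `IsCompact.eventually_forall_of_forall_eventually`); `eventually_forall_posDef` is the
  positive-definiteness corollary.

## References

* S. Lang, *Fundamentals of Differential Geometry* (1999), Ch. VII §1 (Riemannian metrics form an
  open convex cone in the space of symmetric bilinear forms). [folklore]
-/

noncomputable section

-- instance search through nested operator types `V →L V →L ℝ`
set_option maxSynthPendingDepth 3

open Set Filter Metric Function
open scoped Topology

namespace Literature.Analysis.InnerProduct

variable {V : Type*} [NormedAddCommGroup V] [NormedSpace ℝ V]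

/-! ## Coercivity is stable under perturbations small in operator norm -/

/-- `|g(v, v) − g₀(v, v)| ≤ ‖g − g₀‖ ‖v‖²`. [folklore] -/
theorem abs_apply_apply_sub_le (g g₀ : V →L[ℝ] V →L[ℝ] ℝ) (v : V) :
    |g v v - g₀ v v| ≤ ‖g - g₀‖ * ‖v‖ ^ 2 := by
  have h : g v v - g₀ v v = (g - g₀) v v := by simp
  rw [h, ← Real.norm_eq_abs, sq, ← mul_assoc]
  exact ((g - g₀) v).le_of_opNorm_le ((g - g₀).le_opNorm v) v

/-- **Coercivity is stable.** If `λ‖v‖² ≤ g₀(v, v)` for all `v` and `‖g − g₀‖ ≤ μ`, then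
`(λ − μ)‖v‖² ≤ g(v, v)` for all `v`. [folklore] -/
theorem mul_norm_sq_le_of_norm_sub_le {g g₀ : V →L[ℝ] V →L[ℝ] ℝ} {lam μ : ℝ}
    (h₀ : ∀ v, lam * ‖v‖ ^ 2 ≤ g₀ v v) (h : ‖g - g₀‖ ≤ μ) (v : V) :
    (lam - μ) * ‖v‖ ^ 2 ≤ g v v := by
  have h1 := abs_apply_apply_sub_le g g₀ v
  have h2 : ‖g - g₀‖ * ‖v‖ ^ 2 ≤ μ * ‖v‖ ^ 2 := mul_le_mul_of_nonneg_right h (sq_nonneg _)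
  have h3 := h₀ v
  rw [abs_le] at h1
  nlinarith [h1.1]

/-- A coercive form with positive constant is positive definite. [folklore] -/
theorem pos_of_mul_norm_sq_le {g : V →L[ℝ] V →L[ℝ] ℝ} {lam : ℝ} (hlam : 0 < lam)
    (h : ∀ v, lam * ‖v‖ ^ 2 ≤ g v v) {v : V} (hv : v ≠ 0) : 0 < g v v :=
  (mul_pos hlam (by positivity)).trans_le (h v)

/-! ## Finite dimension: positive definite forms are coercive and form an open set -/

section FiniteDimensional

variable [FiniteDimensional ℝ V]

/-- **A positive definite form on a finite-dimensional space is coercive**: there is `λ > 0`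
with `λ‖v‖² ≤ g(v, v)` (`λ` = the minimum of `g(v, v)` over the compact unit sphere; any
`λ > 0` if the space is trivial). [folklore] -/
theorem exists_pos_mul_norm_sq_le_of_pos (g : V →L[ℝ] V →L[ℝ] ℝ) (hg : ∀ v, v ≠ 0 → 0 < g v v) :
    ∃ lam : ℝ, 0 < lam ∧ ∀ v, lam * ‖v‖ ^ 2 ≤ g v v := by
  have hnorm : ∀ {v : V}, v ≠ 0 → ‖v‖⁻¹ • v ∈ sphere (0 : V) 1 := fun {v} hv ↦ by
    rw [mem_sphere_zero_iff_norm, norm_smul, norm_inv, norm_norm,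
      inv_mul_cancel₀ (norm_ne_zero_iff.2 hv)]
  rcases (sphere (0 : V) 1).eq_empty_or_nonempty with hempty | hne
  · refine ⟨1, one_pos, fun v ↦ ?_⟩
    by_cases hv : v = 0
    · simp [hv]
    · exact absurd (hempty ▸ hnorm hv) (notMem_empty _)
  · have hc : Continuous fun v : V ↦ g v v :=
      (g.continuous₂).comp (continuous_id.prodMk continuous_id)
    obtain ⟨v₀, hv₀, hmin⟩ := (isCompact_sphere (0 : V) 1).exists_isMinOn hne hc.continuousOn
    have hv₀0 : v₀ ≠ 0 := by
      intro h0
      have : ‖v₀‖ = 1 := mem_sphere_zero_iff_norm.1 hv₀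
      rw [h0, norm_zero] at this
      exact zero_ne_one this
    refine ⟨g v₀ v₀, hg v₀ hv₀0, fun v ↦ ?_⟩
    by_cases hv : v = 0
    · simp [hv]
    · have hn : 0 < ‖v‖ := norm_pos_iff.2 hv
      have h1 : g v₀ v₀ ≤ g (‖v‖⁻¹ • v) (‖v‖⁻¹ • v) := isMinOn_iff.1 hmin _ (hnorm hv)
      have h2 : g (‖v‖⁻¹ • v) (‖v‖⁻¹ • v) = ‖v‖⁻¹ ^ 2 * g v v := by
        rw [map_smul, map_smul, smul_apply, smul_eq_mul, smul_eq_mul]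
        ring
      rw [h2] at h1
      calc g v₀ v₀ * ‖v‖ ^ 2 ≤ ‖v‖⁻¹ ^ 2 * g v v * ‖v‖ ^ 2 :=
            mul_le_mul_of_nonneg_right h1 (sq_nonneg _)
        _ = g v v := by field_simp

/-- **Positive definiteness is an open condition** on the continuous bilinear forms of a
finite-dimensional real normed space: forms within `λ/2` of a form with coercivity constant `λ`
are coercive with constant `λ/2`. [folklore] -/
theorem isOpen_setOf_posDef : IsOpen {g : V →L[ℝ] V →L[ℝ] ℝ | ∀ v, v ≠ 0 → 0 < g v v} := by
  rw [Metric.isOpen_iff]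
  intro g₀ hg₀
  obtain ⟨lam, hlam, h₀⟩ := exists_pos_mul_norm_sq_le_of_pos g₀ hg₀
  refine ⟨lam / 2, half_pos hlam, fun g hg v hv ↦ ?_⟩
  have hg' : ‖g - g₀‖ ≤ lam / 2 := by
    rw [← dist_eq_norm]
    exact (mem_ball.1 hg).le
  exact pos_of_mul_norm_sq_le (lam := lam - lam / 2) (by linarith)
    (mul_norm_sq_le_of_norm_sub_le h₀ hg') hv

/-! ## Uniform coercivity of a continuous family near a parameter, on a compact set -/

/-- **Uniform coercivity near a parameter value.** Let `g p x` be a continuous bilinear form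
depending on a parameter `p` and a point `x`, jointly continuous on `N × K` for a neighbourhood
`N` of `p₀` and a compact set `K`, and positive definite at `p = p₀` for every `x ∈ K`. Then
there is `λ > 0` such that `λ‖v‖² ≤ g p x (v, v)` for all `x ∈ K`, all `v`, and all `p` in a
neighbourhood of `p₀`. (A positive minimum over the compact `K × unit sphere` at `p₀`, then the
tube lemma `IsCompact.eventually_forall_of_forall_eventually` for the open condition
`‖g p x − g p₀ x‖ < λ₀/2`.) [folklore] -/
theorem eventually_forall_mul_norm_sq_le {P X : Type*} [TopologicalSpace P] [TopologicalSpace X]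
    {K : Set X} (hK : IsCompact K) {g : P → X → V →L[ℝ] V →L[ℝ] ℝ} {p₀ : P} {N : Set P}
    (hN : N ∈ 𝓝 p₀) (hg : ContinuousOn (fun z : P × X ↦ g z.1 z.2) (N ×ˢ K))
    (hpos : ∀ x ∈ K, ∀ v, v ≠ 0 → 0 < g p₀ x v v) :
    ∃ lam : ℝ, 0 < lam ∧ ∀ᶠ p in 𝓝 p₀, ∀ x ∈ K, ∀ v, lam * ‖v‖ ^ 2 ≤ g p x v v := by
  have hp₀N : p₀ ∈ N := mem_of_mem_nhds hN
  -- Step 1: a uniform coercivity constant at `p₀` over `K`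
  have hg₀ : ContinuousOn (fun x ↦ g p₀ x) K :=
    hg.comp (continuousOn_const.prodMk continuousOn_id) fun x hx ↦ ⟨hp₀N, hx⟩
  obtain ⟨lam₀, hlam₀, h₀⟩ : ∃ lam₀ : ℝ, 0 < lam₀ ∧ ∀ x ∈ K, ∀ v, lam₀ * ‖v‖ ^ 2 ≤ g p₀ x v v := by
    have hnorm : ∀ {v : V}, v ≠ 0 → ‖v‖⁻¹ • v ∈ sphere (0 : V) 1 := fun {v} hv ↦ by
      rw [mem_sphere_zero_iff_norm, norm_smul, norm_inv, norm_norm,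
        inv_mul_cancel₀ (norm_ne_zero_iff.2 hv)]
    rcases (K ×ˢ sphere (0 : V) 1).eq_empty_or_nonempty with hempty | hne
    · refine ⟨1, one_pos, fun x hx v ↦ ?_⟩
      by_cases hv : v = 0
      · simp [hv]
      · exact absurd (hempty ▸ mk_mem_prod hx (hnorm hv)) (notMem_empty _)
    · set Φ : X × V → ℝ := fun z ↦ g p₀ z.1 z.2 z.2 with hΦ
      have hΦc : ContinuousOn Φ (K ×ˢ sphere (0 : V) 1) := by
        have h1 : ContinuousOn (fun z : X × V ↦ g p₀ z.1) (K ×ˢ sphere (0 : V) 1) :=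
          hg₀.comp continuousOn_fst fun z hz ↦ hz.1
        have h2 : ContinuousOn (fun z : X × V ↦ (g p₀ z.1, z.2)) (K ×ˢ sphere (0 : V) 1) :=
          h1.prodMk continuousOn_snd
        have h3 : Continuous fun q : (V →L[ℝ] V →L[ℝ] ℝ) × V ↦ q.1 q.2 :=
          isBoundedBilinearMap_apply.continuous
        have h4 : ContinuousOn (fun z : X × V ↦ g p₀ z.1 z.2) (K ×ˢ sphere (0 : V) 1) :=
          h3.comp_continuousOn h2
        have h5 : ContinuousOn (fun z : X × V ↦ (g p₀ z.1 z.2, z.2)) (K ×ˢ sphere (0 : V) 1) :=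
          h4.prodMk continuousOn_snd
        have h6 : Continuous fun q : (V →L[ℝ] ℝ) × V ↦ q.1 q.2 :=
          isBoundedBilinearMap_apply.continuous
        exact h6.comp_continuousOn h5
      obtain ⟨z₀, hz₀, hmin⟩ :=
        (hK.prod (isCompact_sphere (0 : V) 1)).exists_isMinOn hne hΦc
      have hz₀2 : z₀.2 ≠ 0 := by
        intro h0
        have : ‖z₀.2‖ = 1 := mem_sphere_zero_iff_norm.1 hz₀.2
        rw [h0, norm_zero] at this
        exact zero_ne_one this
      refine ⟨Φ z₀, hpos z₀.1 hz₀.1 z₀.2 hz₀2, fun x hx v ↦ ?_⟩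
      by_cases hv : v = 0
      · simp [hv]
      · have hn : 0 < ‖v‖ := norm_pos_iff.2 hv
        have h1 : Φ z₀ ≤ Φ (x, ‖v‖⁻¹ • v) := isMinOn_iff.1 hmin _ (mk_mem_prod hx (hnorm hv))
        have h2 : Φ (x, ‖v‖⁻¹ • v) = ‖v‖⁻¹ ^ 2 * g p₀ x v v := by
          simp only [hΦ]
          rw [map_smul, map_smul, smul_apply, smul_eq_mul, smul_eq_mul]
          ring
        rw [h2] at h1
        calc Φ z₀ * ‖v‖ ^ 2 ≤ ‖v‖⁻¹ ^ 2 * g p₀ x v v * ‖v‖ ^ 2 :=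
              mul_le_mul_of_nonneg_right h1 (sq_nonneg _)
          _ = g p₀ x v v := by field_simp
  -- Step 2: `‖g p x − g p₀ x‖ < λ₀/2` for `p` near `p₀`, uniformly in `x ∈ K` (tube lemma)
  have hnear : ∀ᶠ p in 𝓝 p₀, ∀ x ∈ K, ‖g p x - g p₀ x‖ < lam₀ / 2 := by
    suffices key : ∀ᶠ p in 𝓝 p₀, ∀ x ∈ K, x ∈ K → ‖g p x - g p₀ x‖ < lam₀ / 2 from
      key.mono fun p hp x hx ↦ hp x hx hx
    refine hK.eventually_forall_of_forall_eventually
      (P := fun p y ↦ y ∈ K → ‖g p y - g p₀ y‖ < lam₀ / 2) fun x hx ↦ ?_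
    have hd : ContinuousWithinAt (fun z : P × X ↦ g z.1 z.2 - g p₀ z.2) (N ×ˢ K) (p₀, x) := by
      have h1 : ContinuousWithinAt (fun z : P × X ↦ g z.1 z.2) (N ×ˢ K) (p₀, x) :=
        hg _ ⟨hp₀N, hx⟩
      have h2 : ContinuousWithinAt (fun z : P × X ↦ g p₀ z.2) (N ×ˢ K) (p₀, x) :=
        (hg.comp (continuousOn_const.prodMk continuousOn_snd) fun z hz ↦ ⟨hp₀N, hz.2⟩) _
          ⟨hp₀N, hx⟩
      exact h1.sub h2
    have hlt : ∀ᶠ z in 𝓝[N ×ˢ K] (p₀, x), ‖g z.1 z.2 - g p₀ z.2‖ < lam₀ / 2 := by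
      have hmem : Iio (lam₀ / 2) ∈ 𝓝 (‖g p₀ x - g p₀ x‖) :=
        Iio_mem_nhds (by rw [sub_self, norm_zero]; exact half_pos hlam₀)
      exact hd.norm.preimage_mem_nhdsWithin hmem
    rw [eventually_nhdsWithin_iff] at hlt
    have hN' : ∀ᶠ z : P × X in 𝓝 (p₀, x), z.1 ∈ N := (continuous_fst.tendsto _).eventually hN
    filter_upwards [hlt, hN'] with z hz hzN hzK
    exact hz ⟨hzN, hzK⟩
  -- Step 3: coercivity with constant `λ₀/2`
  refine ⟨lam₀ / 2, half_pos hlam₀, ?_⟩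
  filter_upwards [hnear] with p hp x hx v
  have := mul_norm_sq_le_of_norm_sub_le (h₀ x hx) (hp x hx).le v
  linarith

/-- **Positive definiteness of a continuous family persists near a parameter, uniformly on a
compact set** (corollary of `eventually_forall_mul_norm_sq_le`). [folklore] -/
theorem eventually_forall_posDef {P X : Type*} [TopologicalSpace P] [TopologicalSpace X]
    {K : Set X} (hK : IsCompact K) {g : P → X → V →L[ℝ] V →L[ℝ] ℝ} {p₀ : P} {N : Set P}
    (hN : N ∈ 𝓝 p₀) (hg : ContinuousOn (fun z : P × X ↦ g z.1 z.2) (N ×ˢ K))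
    (hpos : ∀ x ∈ K, ∀ v, v ≠ 0 → 0 < g p₀ x v v) :
    ∀ᶠ p in 𝓝 p₀, ∀ x ∈ K, ∀ v, v ≠ 0 → 0 < g p x v v := by
  obtain ⟨lam, hlam, h⟩ := eventually_forall_mul_norm_sq_le hK hN hg hpos
  filter_upwards [h] with p hp x hx v hv
  exact pos_of_mul_norm_sq_le hlam (hp x hx) hv

end FiniteDimensional

end Literature.Analysis.InnerProduct

end
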